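import Summits.MatrixMultiplication.MatrixMultiplication.Theorems.AbelianSTPPCensusIteratedRoom

/-!
# The iterated room lemma, complement form (cell mm-stpp, eng-1 g4)

`STPPIteratedRoom.card_nsmul_sub_sub_mul_le` (theory g8, p475187) bounds the `k`-fold iterated difference set of a block
`C_t` of an `IsSTPP` family by `|k • (C_t − C_t)| · (V − k s) ≤ V²`, where `V = |A_t||B_t||C_t|` is the size of
`W = A_t − B_t + C_t` and `s` the U14 slack.  The same three-step argument run on the COMPLEMENT `Y = G ∖ W`
(`|Y| = |G| − V`) gives `|k • (C_t − C_t)| · (|G| − V − k s) ≤ (|G| − V)²`, which is the sharper bound whenever the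
member fills more than half of the group (`V > |G|/2`) — the case for every big member of every alive shape list of the
cell's census (e.g. at `|G| = 338`, `V = 216`, `s = 15`: `|2 • (C_t − C_t)| ≤ 161` instead of `250`).
The only new ingredient is the inclusion–exclusion identity `overlap_compl`:
`|Y ∩ (Y + d)| + 2|W| = |W ∩ (W + d)| + |G|`, so a popular difference of `W` with deficiency `s` is a popular difference
of `Y` with the same deficiency.
-/

-- single-conjunct summit: the mandated namespace repeats `MatrixMultiplication`.
set_option linter.dupNamespace false

namespace Summit.MatrixMultiplication.MatrixMultiplication.Theorems

namespace STPPIteratedRoom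

open Finset Literature.Computability.AlgebraicComplexity
open scoped Pointwise

variable {G : Type*} [AddCommGroup G] [DecidableEq G]

/-- **Overlaps of the complement** (inclusion–exclusion): for `Y = G ∖ W`,
`|Y ∩ (Y + d)| + 2|W| = |W ∩ (W + d)| + |G|`. [folklore] -/
theorem overlap_compl [Fintype G] (W : Finset G) (d : G) :
    ((univ \ W).filter (· - d ∈ univ \ W)).card + 2 * W.card =
      (W.filter (· - d ∈ W)).card + Fintype.card G := by
  classical
  set S : Finset G := univ.filter (· - d ∈ W) with hS
  have hSe : S = W.image (· + d) := by
    ext x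
    simp only [hS, mem_filter, mem_univ, true_and, mem_image]
    constructor
    · intro h
      exact ⟨x - d, h, sub_add_cancel x d⟩
    · rintro ⟨w, hw, rfl⟩
      simpa using hw
  have hSc : S.card = W.card := by
    rw [hSe, card_image_of_injective _ (add_left_injective d)]
  have h1 : (univ \ W).filter (· - d ∈ univ \ W) = univ \ (W ∪ S) := by
    ext x
    simp only [hS, mem_filter, mem_sdiff, mem_univ, true_and, mem_union, not_or]
  have h2 : W.filter (· - d ∈ W) = W ∩ S := by
    ext x
    simp only [hS, mem_filter, mem_inter, mem_univ, true_and]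
  have h3 := card_union_add_card_inter W S
  have h4 : (univ \ (W ∪ S)).card = Fintype.card G - (W ∪ S).card := by
    rw [card_sdiff_of_subset (subset_univ _), card_univ]
  have h5 : (W ∪ S).card ≤ Fintype.card G := by
    rw [← card_univ]; exact card_le_card (subset_univ _)
  rw [h1, h2, h4]
  omega

/-- **Deficiency transfers to the complement**: if `|W| ≤ |W ∩ (W + d)| + s` then `|Y| ≤ |Y ∩ (Y + d)| + s` for
`Y = G ∖ W`. [folklore] -/
theorem deficient_compl [Fintype G] (W : Finset G) (d : G) (s : ℕ)
    (h : W.card ≤ (W.filter (· - d ∈ W)).card + s) :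
    (univ \ W).card ≤ ((univ \ W).filter (· - d ∈ univ \ W)).card + s := by
  have h1 := overlap_compl W d
  have h2 : (univ \ W).card = Fintype.card G - W.card := by
    rw [card_sdiff_of_subset (subset_univ _), card_univ]
  have h3 : W.card ≤ Fintype.card G := by
    rw [← card_univ]; exact card_le_card (subset_univ _)
  omega

variable [Fintype G] {N : ℕ} {A B C : Fin N → Finset G}

/-- **Iterated room lemma, complement C-form.**  For an `IsSTPP` family with all `C_u` non-empty in a finite abelian
group `G`, a member `t` with `V = |A_t||B_t||C_t|`, and any `s` with `|G| ≤ V + Σ_{u≠t}|A_u||B_u| + s`: for every `k`,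
`|k • (C_t − C_t)| · (|G| − V − k s) ≤ (|G| − V)²`. [original] -/
theorem card_nsmul_sub_sub_mul_compl_le (h : IsSTPP A B C) (hC : ∀ u, (C u).Nonempty) (t : Fin N) (s k : ℕ)
    (hs : Fintype.card G ≤ (A t).card * (B t).card * (C t).card +
      (∑ u ∈ univ.erase t, (A u).card * (B u).card) + s) :
    (k • (C t - C t)).card * (Fintype.card G - (A t).card * (B t).card * (C t).card - k * s) ≤
      (Fintype.card G - (A t).card * (B t).card * (C t).card) ^ 2 := by
  classical
  set W := A t - B t + C t with hW
  have hV : W.card = (A t).card * (B t).card * (C t).card := card_sub_add_eq h t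
  have hY : (univ \ W).card = Fintype.card G - (A t).card * (B t).card * (C t).card := by
    rw [card_sdiff_of_subset (subset_univ _), card_univ, hV]
  have hpop : ∀ d ∈ C t - C t, (univ \ W).card ≤ ((univ \ W).filter (· - d ∈ univ \ W)).card + s :=
    fun d hd => deficient_compl W d s (room_popular h hC t s hs d hd)
  have := card_nsmul_mul_le (univ \ W) (C t - C t) s hpop k
  rwa [hY] at this

/-- **Iterated room lemma, complement A-form** (rotation `(A,B,C) ↦ (B,C,A)`): with all `A_u` non-empty and
`|G| ≤ V + Σ_{u≠t}|B_u||C_u| + s`, `|k • (A_t − A_t)| · (|G| − V − k s) ≤ (|G| − V)²`. [original] -/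
theorem card_nsmul_sub_sub_mul_compl_le_A (h : IsSTPP A B C) (hA : ∀ u, (A u).Nonempty) (t : Fin N) (s k : ℕ)
    (hs : Fintype.card G ≤ (A t).card * (B t).card * (C t).card +
      (∑ u ∈ univ.erase t, (B u).card * (C u).card) + s) :
    (k • (A t - A t)).card * (Fintype.card G - (A t).card * (B t).card * (C t).card - k * s) ≤
      (Fintype.card G - (A t).card * (B t).card * (C t).card) ^ 2 := by
  have e : (B t).card * (C t).card * (A t).card = (A t).card * (B t).card * (C t).card := by ring
  have := card_nsmul_sub_sub_mul_compl_le h.rotate hA t s k (by rw [e]; exact hs)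
  rwa [e] at this

/-- **Iterated room lemma, complement B-form** (rotation `(A,B,C) ↦ (C,A,B)`): with all `B_u` non-empty and
`|G| ≤ V + Σ_{u≠t}|C_u||A_u| + s`, `|k • (B_t − B_t)| · (|G| − V − k s) ≤ (|G| − V)²`. [original] -/
theorem card_nsmul_sub_sub_mul_compl_le_B (h : IsSTPP A B C) (hB : ∀ u, (B u).Nonempty) (t : Fin N) (s k : ℕ)
    (hs : Fintype.card G ≤ (A t).card * (B t).card * (C t).card +
      (∑ u ∈ univ.erase t, (C u).card * (A u).card) + s) :
    (k • (B t - B t)).card * (Fintype.card G - (A t).card * (B t).card * (C t).card - k * s) ≤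
      (Fintype.card G - (A t).card * (B t).card * (C t).card) ^ 2 := by
  have e : (C t).card * (A t).card * (B t).card = (A t).card * (B t).card * (C t).card := by ring
  have := card_nsmul_sub_sub_mul_compl_le h.rotate.rotate hB t s k (by rw [e]; exact hs)
  rwa [e] at this

end STPPIteratedRoom

end Summit.MatrixMultiplication.MatrixMultiplication.Theorems
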